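import Summits.QuantumFields.BalabanUV.T4Continuum.Support.ShellMeasureDecayKernelSums

/-!
# `T4Continuum.ShellMeasureDecayKernelSchur` — «WALL ROWS R06∕R09, THE w-TUPLE: THE SUP-NORM OPERATOR BOUNDS OF THE PINNED
# KERNELS ARE THE SCHUR TEST OF THEIR OWN DECAY ROWS» — the reduced-rate row sum dominates the full-rate one on a NONNEGATIVE
# distance, hence `‖kerOp k A‖_∞ ≤ c₀·M·‖A‖_∞` from the two DISPLAYED decay binders alone, and the number-junction form
# `c₀·M ≤ B ⟹ ‖kerOp k A‖ ≤ B·‖A‖`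
(cell `pub-balaban`, sub-cell `t4`, spine estimate NE7c (node U5b); NE7c ROUND-2 crew `t4-ne7c-formalise-*`, unit
`b2b-balaban-t4-ne7c-formalise-leaf-04` gen 11, own initiative on the owner's ONE-CALL census `t4/b2b-balaban-t4-ne7c-p1/
ONECALL-CENSUS-NE7c.md` v1.8 rows R06∕R09 (journal INTENT of this unit); ADDITIVE — imports S66 f3a `ShellMeasureDecayKernelSums`
(leaf-06-g4, `kerOp`, `norm_kerOp_le`, `rowSum_le_of_decay`) ONLY; [folklore]; 0 `def`, 0 `def … : Prop`, 0 sorry, 0 citation tags)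

HONEST FRAMING.  Finite four-torus programme, rung (B)+1 only — NOT infinite volume, NOT a mass gap, NOT the Clay problem, NOT
summit progress; (B), `BetaPertHyp`, (B^μ) are not consumed.  NE7c (`T4IndicatorShell.ShellWeightBound` for the cell's expansions)
is NOT PRINTED in [Balaban 1983–89] and NOT PROVED; «NE7c ⇐ the named binders» (trigger c3).  ELEMENTARY bookkeeping on OUR side
(finite sums, the `∞→∞` Schur test); nothing printed is asserted, cited or discharged.  HONEST DEPENDENCY (cell): continuum YM on
T⁴ ⇐ BetaPertH ∧ nine spine estimates (0/9 proved); BetaPertH ⇐ (D1) ∧ (D4) ∧ CAP+tail; G-an2-4 gates asym, D1 and NE2/3/4.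

THE POINT.  THE ONE CALL OF RECORD v3 (`ShellMeasureLiveEndOneCallUnionLevelsCfLin.shellWeightBound_live_oneCall_union_levels_cfB7_lin`,
p237431; and every END host since S80 f3 `…AssembledDecay`) carries, for the w-tuple (the GLOBAL minimiser's Wilson-slot scheme read
through DECAY KERNELS), BOTH halves of the [B9] Thm 3.13 ∕ B11 (73)∕(46)∕(103) TYPE for the four linear letters as SEPARATE hypotheses:
* the DECAY rows `hk𝒢 : ‖k𝒢 V c b′‖ ≤ c𝒢·e^{−δ𝒢·dis(pos c, posz b′)}`, `hkH`, `hkH₁` (and `hkι`) with the REDUCED-RATE uniform sums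
  `hM𝒢′ : ∀ x, Σ_{b′} e^{−(δ𝒢−δw)·dis(x, posz b′)} ≤ M𝒢`, `hMH′`, `hMH₁′` (the pinned-norm currency of S70, margin `δw ≥ 0` = `hδw`);
* the SUP-NORM operator rows `h𝒢w : ‖kerOp (k𝒢 V) f‖ ≤ B₀w·‖f‖`, `hHw : ‖kerOp (kH V) X‖ ≤ B₀w·‖X‖`, `hH₁w : ‖kerOp (kH₁ V) B‖ ≤ B₀w·‖B‖`
  — THREE hypotheses of census class [T] (rows R06∕R09, WALL §3 W-a).
Since these operators ARE `kerOp` of the displayed kernels (not abstract maps, unlike the u-∕e-tuples' `𝒢 Hop H₁ 𝒢e He H₁e`), the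
second group is the SCHUR TEST of the first: `‖kerOp k A‖_∞ ≤ (max row sum)·‖A‖_∞ ≤ c₀·(Σ_{b′} e^{−δ·dis})·‖A‖_∞` (S66 f3a
`norm_kerOp_le ∘ rowSum_le_of_decay`), and on a NONNEGATIVE distance the full-rate sum is dominated by the reduced-rate one
(`e^{−δ·D} ≤ e^{−(δ−δw)·D}` iff `δw·D ≥ 0`).  THIS FILE proves exactly that junction, generically (any `RCLike` scalars, any finite
index sets placed by `posIn`∕`posOut` in a set `S` with a distance-like `ρ`):
* §1 `sum_exp_le_sum_exp_of_rate` (rate monotonicity under `0 ≤ δw`, `0 ≤ ρ`), `rowSum_le_of_decay_reduced` (row sums `≤ c₀·M`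
  from decay at rate `δ` and the uniform sum at rate `δ − δw`);
* §2 **`norm_kerOp_le_of_decay_reduced`** (`‖kerOp k A‖ ≤ c₀·M·‖A‖`), `opNorm_kerOp_le_of_decay_reduced`, and the NUMBER-JUNCTION
  forms **`norm_kerOp_le_of_decay_junction`** ∕ `opNorm_kerOp_le_of_decay_junction` (`c₀·M ≤ B ⟹ ‖kerOp k A‖ ≤ B·‖A‖`) — the
  LITERAL shape of `h𝒢w`∕`hHw`∕`hH₁w` once `V` is fixed;
* §3 `nonneg_dist_needed` — the sign hypothesis is NOT idle: on a two-point index set with `ρ ≡ −1`, `δ = δw = 1`, the full-rate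
  sum `2e` exceeds the reduced-rate sum `2` (so a host that wants the junction must DISPLAY `0 ≤ dis`, a structural property of the
  designed coarse-blocked lattice distance of record, owner R-ne7cp1-g35-2 (a); it is not derivable from the one-sided Lipschitz row
  `hϖw : ϖ x ≤ ϖ y + dis x y` alone).
EXPECTED USE (the owner labels∕books∕vetoes; census arithmetic is the owner's two engines'): an END host re-fired with `h𝒢w hHw hH₁w`
DERIVED in-file — LEAVING 3 [T]; ENTERING `hdis : ∀ x y, 0 ≤ dis x y` (structural) and the number junctions `c𝒢·M𝒢 ≤ B₀w`,
`cH·MH ≤ B₀w`, `cH₁·MH₁ ≤ B₀w` (class N, the R10p pattern).  `hιw : ‖kerOp (kι V) Y‖ ≤ ‖Y‖` is deliberately NOT re-sourced: its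
only Schur constant available from the displayed rows is `cι·Mι` (the reduced-rate sum over ALL of `Λw`), and `cι·Mι ≤ 1` is not a
faithful stand-in for a norm-one restriction-type letter.  HONEST: nothing of Bałaban's is discharged — the decay halves (and their
sums) REMAIN displayed wall rows of printed TYPE; what leaves is OUR double bookkeeping of their sup-norm corollary (in print, too, the
`L^∞` operator bound of a kernel with exponential decay IS its row sum).  NOTHING in the countdown moves; NE7c NOT PROVED; spine 0∕9.
-/

noncomputable section

namespace Summit.QuantumFields.BalabanUV.T4Continuum.ShellMeasureDecayKernelSchur

open ShellMeasureDecayKernelSums (kerOp norm_kerOp_le opNorm_kerOp_le rowSum_le_of_decay)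

variable {𝕜 : Type*} [RCLike 𝕜] {Λ Λ' S : Type*}
variable {𝔄 𝔅 : Type*} [NormedAddCommGroup 𝔄] [NormedSpace 𝕜 𝔄] [NormedAddCommGroup 𝔅] [NormedSpace 𝕜 𝔅]

/-! ## §1 Rate monotonicity and the reduced-rate row sum -/

/-- **RATE MONOTONICITY**: on a nonnegative distance-like `ρ` and a margin `0 ≤ δw`, every term `e^{−δ·ρ(x, posIn b)}` is at most
`e^{−(δ−δw)·ρ(x, posIn b)}`, hence so are the sums over a finite index set. [folklore] -/
theorem sum_exp_le_sum_exp_of_rate [Fintype Λ] (ρ : S → S → ℝ) (posIn : Λ → S) {δ δw : ℝ} (hδw : 0 ≤ δw)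
    (hρ : ∀ x y, 0 ≤ ρ x y) (x : S) :
    ∑ b, Real.exp (-(δ * ρ x (posIn b))) ≤ ∑ b, Real.exp (-((δ - δw) * ρ x (posIn b))) :=
  Finset.sum_le_sum fun b _ => Real.exp_le_exp.2 (by nlinarith [hρ x (posIn b)])

/-- **DECAY AT RATE `δ` + THE UNIFORM SUM AT THE REDUCED RATE `δ − δw` ⇒ ROW SUMS `≤ c₀·M`** (for `0 ≤ δw`, `0 ≤ ρ`):
the displayed pair (`hk𝒢`, `hM𝒢′`) of the END hosts, read as a row-sum bound. [folklore] -/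
theorem rowSum_le_of_decay_reduced [Fintype Λ] (k : Λ' → Λ → (𝔄 →L[𝕜] 𝔅)) (ρ : S → S → ℝ) (posIn : Λ → S)
    (posOut : Λ' → S) {c₀ δ δw M : ℝ} (hc₀ : 0 ≤ c₀) (hδw : 0 ≤ δw) (hρ : ∀ x y, 0 ≤ ρ x y)
    (hk : ∀ c b, ‖k c b‖ ≤ c₀ * Real.exp (-(δ * ρ (posOut c) (posIn b))))
    (hM : ∀ x : S, ∑ b, Real.exp (-((δ - δw) * ρ x (posIn b))) ≤ M) (c : Λ') : ∑ b, ‖k c b‖ ≤ c₀ * M :=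
  rowSum_le_of_decay k ρ posIn posOut hc₀ hk (fun x => (sum_exp_le_sum_exp_of_rate ρ posIn hδw hρ x).trans (hM x)) c

/-! ## §2 The Schur junction: the sup-norm operator bound from the decay rows, and its number-junction form -/

/-- **THE SCHUR JUNCTION**: `‖k c b‖ ≤ c₀·e^{−δ·ρ(posOut c, posIn b)}`, `∀ x, Σ_b e^{−(δ−δw)·ρ(x, posIn b)} ≤ M`, `0 ≤ c₀, M, δw`,
`0 ≤ ρ` ⟹ `‖kerOp k A‖ ≤ c₀·M·‖A‖` for every bond field `A` (sup norms on both sides). [folklore] -/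
theorem norm_kerOp_le_of_decay_reduced [Fintype Λ] [Fintype Λ'] (k : Λ' → Λ → (𝔄 →L[𝕜] 𝔅)) (ρ : S → S → ℝ)
    (posIn : Λ → S) (posOut : Λ' → S) {c₀ δ δw M : ℝ} (hc₀ : 0 ≤ c₀) (hM0 : 0 ≤ M) (hδw : 0 ≤ δw)
    (hρ : ∀ x y, 0 ≤ ρ x y) (hk : ∀ c b, ‖k c b‖ ≤ c₀ * Real.exp (-(δ * ρ (posOut c) (posIn b))))
    (hM : ∀ x : S, ∑ b, Real.exp (-((δ - δw) * ρ x (posIn b))) ≤ M) (A : Λ → 𝔄) :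
    ‖kerOp k A‖ ≤ c₀ * M * ‖A‖ :=
  norm_kerOp_le k (mul_nonneg hc₀ hM0) (rowSum_le_of_decay_reduced k ρ posIn posOut hc₀ hδw hρ hk hM) A

/-- … hence the operator norm: `‖kerOp k‖ ≤ c₀·M`. [folklore] -/
theorem opNorm_kerOp_le_of_decay_reduced [Fintype Λ] [Fintype Λ'] (k : Λ' → Λ → (𝔄 →L[𝕜] 𝔅)) (ρ : S → S → ℝ)
    (posIn : Λ → S) (posOut : Λ' → S) {c₀ δ δw M : ℝ} (hc₀ : 0 ≤ c₀) (hM0 : 0 ≤ M) (hδw : 0 ≤ δw)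
    (hρ : ∀ x y, 0 ≤ ρ x y) (hk : ∀ c b, ‖k c b‖ ≤ c₀ * Real.exp (-(δ * ρ (posOut c) (posIn b))))
    (hM : ∀ x : S, ∑ b, Real.exp (-((δ - δw) * ρ x (posIn b))) ≤ M) : ‖kerOp k‖ ≤ c₀ * M :=
  opNorm_kerOp_le k (mul_nonneg hc₀ hM0) (rowSum_le_of_decay_reduced k ρ posIn posOut hc₀ hδw hρ hk hM)

/-- **THE NUMBER-JUNCTION FORM** — LITERALLY the shape of the END hosts' `h𝒢w`∕`hHw`∕`hH₁w` at a fixed exterior section: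
the decay pair + `0 ≤ δw` + `0 ≤ ρ` + ONE number relation `c₀·M ≤ B` ⟹ `‖kerOp k A‖ ≤ B·‖A‖`. [folklore] -/
theorem norm_kerOp_le_of_decay_junction [Fintype Λ] [Fintype Λ'] (k : Λ' → Λ → (𝔄 →L[𝕜] 𝔅)) (ρ : S → S → ℝ)
    (posIn : Λ → S) (posOut : Λ' → S) {c₀ δ δw M B : ℝ} (hc₀ : 0 ≤ c₀) (hM0 : 0 ≤ M) (hδw : 0 ≤ δw)
    (hρ : ∀ x y, 0 ≤ ρ x y) (hk : ∀ c b, ‖k c b‖ ≤ c₀ * Real.exp (-(δ * ρ (posOut c) (posIn b))))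
    (hM : ∀ x : S, ∑ b, Real.exp (-((δ - δw) * ρ x (posIn b))) ≤ M) (hB : c₀ * M ≤ B) (A : Λ → 𝔄) :
    ‖kerOp k A‖ ≤ B * ‖A‖ :=
  (norm_kerOp_le_of_decay_reduced k ρ posIn posOut hc₀ hM0 hδw hρ hk hM A).trans
    (mul_le_mul_of_nonneg_right hB (norm_nonneg A))

/-- … and for the operator norm: `c₀·M ≤ B ⟹ ‖kerOp k‖ ≤ B`. [folklore] -/
theorem opNorm_kerOp_le_of_decay_junction [Fintype Λ] [Fintype Λ'] (k : Λ' → Λ → (𝔄 →L[𝕜] 𝔅)) (ρ : S → S → ℝ)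
    (posIn : Λ → S) (posOut : Λ' → S) {c₀ δ δw M B : ℝ} (hc₀ : 0 ≤ c₀) (hM0 : 0 ≤ M) (hδw : 0 ≤ δw)
    (hρ : ∀ x y, 0 ≤ ρ x y) (hk : ∀ c b, ‖k c b‖ ≤ c₀ * Real.exp (-(δ * ρ (posOut c) (posIn b))))
    (hM : ∀ x : S, ∑ b, Real.exp (-((δ - δw) * ρ x (posIn b))) ≤ M) (hB : c₀ * M ≤ B) : ‖kerOp k‖ ≤ B :=
  (opNorm_kerOp_le_of_decay_reduced k ρ posIn posOut hc₀ hM0 hδw hρ hk hM).trans hB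

/-- **THE `V`-INDEXED FORM** used by the END hosts (kernels indexed by the exterior section `V : 𝒱`, the decay row uniform in
`V`): `∀ V A, ‖kerOp (k V) A‖ ≤ B·‖A‖`. [folklore] -/
theorem norm_kerOp_le_of_decay_junction_family {𝒱 : Type*} [Fintype Λ] [Fintype Λ'] (k : 𝒱 → Λ' → Λ → (𝔄 →L[𝕜] 𝔅))
    (ρ : S → S → ℝ) (posIn : Λ → S) (posOut : Λ' → S) {c₀ δ δw M B : ℝ} (hc₀ : 0 ≤ c₀) (hM0 : 0 ≤ M) (hδw : 0 ≤ δw)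
    (hρ : ∀ x y, 0 ≤ ρ x y) (hk : ∀ V c b, ‖k V c b‖ ≤ c₀ * Real.exp (-(δ * ρ (posOut c) (posIn b))))
    (hM : ∀ x : S, ∑ b, Real.exp (-((δ - δw) * ρ x (posIn b))) ≤ M) (hB : c₀ * M ≤ B) (V : 𝒱) (A : Λ → 𝔄) :
    ‖kerOp (k V) A‖ ≤ B * ‖A‖ :=
  norm_kerOp_le_of_decay_junction (k V) ρ posIn posOut hc₀ hM0 hδw hρ (hk V) hM hB A

/-! ## §3 The sign hypothesis is not idle -/

/-- **`0 ≤ ρ` IS NEEDED for rate monotonicity**: on the two-point index set `Bool` placed by the identity in `Bool`, with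
`ρ ≡ −1`, `δ = δw = 1`, the full-rate sum is `2e` while the reduced-rate sum is `2` — the reduced-rate uniform-sum row alone does
NOT dominate the full-rate row sums without a sign on the distance. [folklore] -/
theorem nonneg_dist_needed :
    ¬ (∑ b : Bool, Real.exp (-((1 : ℝ) * (fun _ _ : Bool => (-1 : ℝ)) true (id b))) ≤
        ∑ b : Bool, Real.exp (-(((1 : ℝ) - 1) * (fun _ _ : Bool => (-1 : ℝ)) true (id b)))) := by
  simp only [mul_neg, mul_one, neg_neg, sub_self, neg_zero, Real.exp_zero, Fintype.sum_bool, not_le]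
  have : (1 : ℝ) < Real.exp 1 := Real.one_lt_exp_iff.2 one_pos
  linarith

end Summit.QuantumFields.BalabanUV.T4Continuum.ShellMeasureDecayKernelSchur

end

/-! ## §4 (v1.1, APPEND-ONLY) The entering number junctions are jointly inhabitable with an END host's `B₀w`-rows (crew rule G-1;
owner R-ne7cp1-g36-10 (b) header item (3)) -/

namespace Summit.QuantumFields.BalabanUV.T4Continuum.ShellMeasureDecayKernelSchur

/-- **PARAMETRIC JOINT INHABITATION of the number rows touched by the Schur junction** (crew rule G-1, for ANY values of the tree
constants): for any nonnegative Schur products `G₁ G₂ G₃` (the host's `c𝒢·M𝒢`, `cH₁·MH₁`, `cH·MH`), any (P4) constant `C₄ ≥ 0`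
(`C₄w`), any `C₂ ≥ 0` (the host's `C2cov d`), any `R > 0` (`landauRad d L`) and any pin factor `E ≥ 1` (`e^{δw·rW}`), there are a shared
operator letter `B` (`B₀w`), a self-map size `ε` (`ε₄w`), a coarse-datum size `b` (`bw`) and a (P4) radius `a` (`a₃w`) satisfying the
three ENTERING junctions `G· ≤ B`, the host's `hB₀w hε₄w`, `hdomw : 2(ε + B·b) ≤ a`, `hselfw : B·C₄·(ε + B·b)² ≤ ε`,
`hcontrw : 4·B·C₄·(ε + B·b) < 1`, `hqw : 9·C₂·B·(ε + B·b) < 1`, `hRCw : 6(ε + B·b) ≤ R`, and `hqW`'s radius constraint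
`G₁·(2·C₄·a·E) < 1`, with `b > 0` (room for `hTbw : ‖Tw V‖·rΦw < b`) and `a > 0`.  Choice: `B := G₁+G₂+G₃+1`, `a := 1∕(2BC₄E+1)`,
`X := ½·min(a∕2, 1∕(9C₂B+1), R∕6)`, `ε := X∕2`, `b := X∕(2B)`.  Arithmetic on OUR letters only; nothing printed. [folklore] -/
theorem numberRows_inhabited {G₁ G₂ G₃ C₄ C₂ R E : ℝ} (hG₁ : 0 ≤ G₁) (hG₂ : 0 ≤ G₂) (hG₃ : 0 ≤ G₃)
    (hC₄ : 0 ≤ C₄) (hC₂ : 0 ≤ C₂) (hR : 0 < R) (hE : 1 ≤ E) :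
    ∃ B ε b a : ℝ, G₁ ≤ B ∧ G₂ ≤ B ∧ G₃ ≤ B ∧ 0 < B ∧ 0 ≤ ε ∧ 0 < b ∧ 0 < a ∧
      2 * (ε + B * b) ≤ a ∧ B * C₄ * (ε + B * b) ^ 2 ≤ ε ∧ 4 * B * C₄ * (ε + B * b) < 1 ∧
      9 * C₂ * B * (ε + B * b) < 1 ∧ 6 * (ε + B * b) ≤ R ∧ G₁ * (2 * C₄ * a * E) < 1 := by
  -- the shared operator letter: any common upper bound of the three Schur products, positive
  set B : ℝ := G₁ + G₂ + G₃ + 1 with hBdef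
  have hB0 : 0 < B := by rw [hBdef]; linarith
  have hB1 : G₁ ≤ B := by rw [hBdef]; linarith
  -- the (P4) radius: small enough for `hqW`'s factor `2·C₄·a·E·(c𝒢M𝒢) < 1`
  set a : ℝ := 1 / (2 * B * C₄ * E + 1) with hadef
  have hden : 0 < 2 * B * C₄ * E + 1 := by
    have : 0 ≤ 2 * B * C₄ * E := by positivity
    linarith
  have ha0 : 0 < a := by rw [hadef]; positivity
  have haE : 2 * B * C₄ * E * a < 1 := by
    rw [hadef, mul_one_div, div_lt_one hden]; linarith
  have ha1 : 2 * B * C₄ * a < 1 := by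
    have : 2 * B * C₄ * a ≤ 2 * B * C₄ * E * a := by
      have h0 : 0 ≤ 2 * B * C₄ * a := by positivity
      nlinarith
    linarith
  -- the letter size `X = ε + B·b`: strictly inside the three windows `a∕2`, `1∕(9C₂B+1)`, `R∕6`
  set X : ℝ := min (a / 2) (min (1 / (9 * C₂ * B + 1)) (R / 6)) / 2 with hXdef
  have h9 : 0 < 9 * C₂ * B + 1 := by
    have : 0 ≤ 9 * C₂ * B := by positivity
    linarith
  have hm0 : 0 < min (a / 2) (min (1 / (9 * C₂ * B + 1)) (R / 6)) := lt_min (by positivity) (lt_min (by positivity) (by positivity))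
  have hX0 : 0 < X := by rw [hXdef]; positivity
  have hXa : X < a / 2 := by
    rw [hXdef]; have := min_le_left (a / 2) (min (1 / (9 * C₂ * B + 1)) (R / 6)); linarith
  have hX9 : X < 1 / (9 * C₂ * B + 1) := by
    rw [hXdef]
    have := (min_le_right (a / 2) _).trans (min_le_left (1 / (9 * C₂ * B + 1)) (R / 6)); linarith
  have hXR : X < R / 6 := by
    rw [hXdef]; have := (min_le_right (a / 2) _).trans (min_le_right (1 / (9 * C₂ * B + 1)) (R / 6)); linarith
  refine ⟨B, X / 2, X / (2 * B), a, hB1, by rw [hBdef]; linarith, by rw [hBdef]; linarith, hB0, by positivity, by positivity,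
    ha0, ?_, ?_, ?_, ?_, ?_, by nlinarith [mul_nonneg (mul_nonneg (mul_nonneg hC₄ ha0.le) (by linarith : (0:ℝ) ≤ E)) hG₁]⟩
  all_goals have hsum : X / 2 + B * (X / (2 * B)) = X := by field_simp; ring
  all_goals rw [hsum]
  · linarith
  · -- `B·C₄·X² ≤ X∕2` from `2BC₄X ≤ 1` (itself from `4BC₄X < 1`)
    have h4 : 4 * B * C₄ * X < 1 := by nlinarith [mul_nonneg (mul_nonneg hB0.le hC₄) hX0.le]
    nlinarith [mul_nonneg (mul_nonneg hB0.le hC₄) hX0.le]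
  · nlinarith [mul_nonneg (mul_nonneg hB0.le hC₄) hX0.le]
  · have : 9 * C₂ * B * X < (9 * C₂ * B + 1) * (1 / (9 * C₂ * B + 1)) := by
      have h0 : 0 ≤ 9 * C₂ * B := by positivity
      calc 9 * C₂ * B * X ≤ (9 * C₂ * B + 1) * X := by nlinarith
        _ < (9 * C₂ * B + 1) * (1 / (9 * C₂ * B + 1)) := by gcongr
    rwa [mul_one_div_cancel h9.ne'] at this
  · linarith

end Summit.QuantumFields.BalabanUV.T4Continuum.ShellMeasureDecayKernelSchur
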